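/-
Copyright: b2b-lace packet (explicit-unit carver, gen 18).  The summability binder `hH` of the weighted-bubble tail
and skeleton theorems (`WeightedBubbleTail`, `WeightedBubbleSkeleton`: "whenever the series defining `ℋ^{1,n}_p(0)`
converges") DISCHARGED for every `p < p_c` (`d ≥ 2`): `‖y‖₂² τ_p(y)` is summable below `p_c` ([NoBLE17-I]
Assumption 2.3 for percolation, the tree's `summable_euclidNorm_sq_mul_tau`) and `(D^{⋆n} ⋆ τ_p)(y) ≤ 1`.
-/
import Literature.Probability.FitznerVanDerHofstad2017.WeightedBubbleSkeleton
import Literature.Barriers.CriticalPhenomena.GaussianDominationRouteNobleProofs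
import HarnessLib

/-!
# The weighted-bubble skeleton below `p_c`: the summability hypothesis discharged

CITATION HEADER (PLACEMENT v2). This module is part of a certified REPRODUCTION of:
R. Fitzner, R. van der Hofstad, *Mean-field behavior for nearest-neighbor percolation in d > 10*,
Electron. J. Probab. 22 (2017), no. 43, 1–65 [FvdH17], and *Generalized approach to the non-backtracking
lace expansion*, Probab. Theory Related Fields 169 (2017), 1041–1119 [NoBLE17-I] (arXiv:1506.07977, 1506.07969).
Reproduces: [NoBLE17-I] §5.3.3 last paragraph (the tail of the weighted repulsive bubble lands on `f₃`) and
§5.3.1 (5.38) iterated to a general cut `M` — the tree's `WeightedBubbleTail` / `WeightedBubbleSkeleton` — with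
their only analytic side condition, convergence of the series `ℋ^{1,n}_p(0) = Σ_y ‖y‖₂² τ_p(y) (D^{⋆n} ⋆ τ_p)(y)`,
proved for every subcritical `p` from [NoBLE17-I] Assumption 2.3 for percolation ("`Σ_x ‖x‖₂² G_z(x) < ∞` for
`z < z_c`"; [FvdH17] §2.4: verified from the exponential decay of `τ_p` below `p_c`, [Grim99] Thm. 6.1), which is
the tree's `summable_euclidNorm_sq_mul_tau` (`GaussianDominationRouteNobleProofs`).  Origin: build `lace`, node
N67 (typer checklist item T4 of the packet's `N67-INSTANCE-CHECK.md`) of `LEMMAS.md`.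

## What is here

* `srwConvTau_le_one` — `(D^{⋆n} ⋆ τ_p)(y) ≤ 1` for all `p`, `n`, `y` (`τ_p ≤ 1`, `Σ D^{⋆n} ≤ 1`);
* `summable_sq_mul_tau_mul_srwConv` — for `d ≥ 2` and `p < p_c`, the series
  `Σ_y ‖y‖₂² τ_p(y) (D^{⋆n} ⋆ τ_p)(y)` converges (comparison with `Σ_y ‖y‖₂² τ_p(y)`); `…_of_lt_criticalProbI` is
  the same with the hypothesis in `unitInterval` form `p < criticalProbI d`;
* the four `hH`-consumers of the tree with `hH` discharged, for `p < p_c`: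
  `sum_sq_weighted_repBubbleTail_le_nobleH_of_subcritical`, `tsum_sq_weighted_repBubbleTail_le_nobleH_of_subcritical`
  (`Σ_y ‖y‖₂² P_p({0 ←n→ y} ∘ {y ↔ 0}) ≤ (2dp)^n ℋ^{1,n}_p(0)`), `tsum_sq_weighted_repBubble_le_skeleton_of_subcritical`,
  `tsum_sq_weighted_repBubble_le_skeleton_tau_of_subcritical` (the general-cut skeleton
  `(G_{m,z} ⊗_w H_z)(0) ≤ explicit(i = m..M) + (2dp)^{M+1} ℋ^{1,M+1}_p(0)`).

So on `[1/(2d-1), p_c)`, the interval of the bootstrap, the skeleton holds with NO side condition; the tail term is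
the `(1, M + 1, {0})` weighted diagram of `f₃` (`NobleInstantiateFamily.nobleTripleSnoc d (1, M + 1, {0})`).

## What is NOT here

No bound on `ℋ^{1,n}_p(0)` itself (that is the bootstrap HYPOTHESIS `f₃ ≤ Γ₃`), no numerals, no dimension; nothing
of the record is touched.  No cited fact, no named hypothesis, no `sorry`.

## References
* [NoBLE17-I] R. Fitzner, R. van der Hofstad, Generalized approach to the non-backtracking lace expansion,
  Probab. Theory Relat. Fields 169 (2017) 1041–1119; arXiv:1506.07969 — Assumption 2.3, §5.3.1 (5.38), §5.3.3.
* [FvdH17] R. Fitzner, R. van der Hofstad, Mean-field behavior for nearest-neighbor percolation in `d > 10`,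
  Electron. J. Probab. 22 (2017) no. 43; arXiv:1506.07977v2 — §2.4 (claim on [FitHof13b] Assumption 2.3), (2.21).
* G. Grimmett, Percolation, 2nd ed., Springer 1999 — Thm. 6.1 (exponential decay below `p_c`).
-/

noncomputable section

namespace Literature.Probability.FitznerVanDerHofstad2017

open _root_.MeasureTheory Literature.Barriers.CriticalPhenomena Literature.Probability.Percolation
open Literature.Probability.LatticeModels
open Literature.Barriers.CriticalPhenomena.SpreadOutIsing (latticeConv convPow)
open scoped BigOperators ENNReal

variable {d : ℕ}

/-! ### The kernel `D^{⋆n} ⋆ τ_p` is bounded by one -/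

/-- `(D^{⋆n} ⋆ τ_p)(y) ≤ 1`: `τ_p ≤ 1` and `Σ_w D^{⋆n}(w) = (Σ D)^n ≤ 1`. [folklore] -/
theorem srwConvTau_le_one (p : unitInterval) (n : ℕ) (y : Site d) :
    latticeConv (convPow (srwStep d) n) (tau d p 0) y ≤ 1 := by
  have hD : Summable (convPow (srwStep d) n) :=
    summable_convPow_of_summable summable_srwStep srwStep_nonneg n
  refine (latticeConv_le_tsum_mul hD (convPow_nonneg_of_nonneg srwStep_nonneg n)
    (fun x => tau_nonneg p 0 x) (fun x => tau_le_one p 0 x) y).trans ?_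
  rw [mul_one, tsum_convPow summable_srwStep srwStep_nonneg n]
  exact pow_le_one₀ (tsum_nonneg srwStep_nonneg) tsum_srwStep_le_one

/-! ### Summability of the series `ℋ^{1,n}_p(0)` below `p_c` -/

/-- **For `d ≥ 2` and `p < p_c` the series `Σ_y ‖y‖₂² τ_p(y) (D^{⋆n} ⋆ τ_p)(y)` (= `ℋ^{1,n}_p(0)`,
`tsum_sq_mul_tau_mul_srwConv_eq_nobleH`) converges**: comparison with `Σ_y ‖y‖₂² τ_p(y) < ∞` ([NoBLE17-I]
Assumption 2.3 for percolation, the tree's `summable_euclidNorm_sq_mul_tau`) using `(D^{⋆n} ⋆ τ_p) ≤ 1`.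
[cite: FitznerVanDerHofstad2016NoBLE, Assumption 2.3 and Lemma 3.5 (proof)]
[cite: FitznerVanDerHofstad2017, §2.4 ("[FitHof13b Assumption 2.3]: Growth of the two-point function")] -/
theorem summable_sq_mul_tau_mul_srwConv (hd : 2 ≤ d) (p : unitInterval)
    (hp : (p : ℝ) < criticalProb (zdGraph d) (0 : Site d)) (n : ℕ) :
    Summable fun y : Site d =>
      euclidNorm y ^ 2 * (tau d p 0 y * latticeConv (convPow (srwStep d) n) (tau d p 0) y) := by
  refine Summable.of_nonneg_of_le (fun y => sq_mul_tau_mul_srwConv_nonneg p n y) (fun y => ?_)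
    (summable_euclidNorm_sq_mul_tau hd p hp)
  rw [← mul_assoc]
  exact mul_le_of_le_one_right (mul_nonneg (sq_nonneg _) (tau_nonneg p 0 y)) (srwConvTau_le_one p n y)

/-- The same with the hypothesis in `unitInterval` form, `p < criticalProbI d`. [folklore] -/
theorem summable_sq_mul_tau_mul_srwConv_of_lt_criticalProbI (hd : 2 ≤ d) {p : unitInterval}
    (hp : p < criticalProbI d) (n : ℕ) :
    Summable fun y : Site d =>
      euclidNorm y ^ 2 * (tau d p 0 y * latticeConv (convPow (srwStep d) n) (tau d p 0) y) := by
  refine summable_sq_mul_tau_mul_srwConv hd p ?_ n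
  rw [← coe_criticalProbI]
  exact Subtype.coe_lt_coe.2 hp

/-! ### The tail and skeleton theorems below `p_c`, side condition discharged -/

/-- **The tail lands on `f₃`, finite set of pivots, `p < p_c` (`d ≥ 2`)**:
`Σ_{y ∈ S} ‖y‖₂² P_p({0 ←n→ y} ∘ {y ↔ 0}) ≤ (2dp)^n ℋ^{1,n}_p(0)` — the tree's
`sum_sq_weighted_repBubbleTail_le_nobleH` with `hH` discharged.
[cite: FitznerVanDerHofstad2016NoBLE, §5.3.3 last paragraph (PTRF 169 (2017) p. 1099)]
[cite: FitznerVanDerHofstad2017, §4.2 (4.3), (4.12); §2.2 (2.21)–(2.23)] -/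
theorem sum_sq_weighted_repBubbleTail_le_nobleH_of_subcritical (hd : 2 ≤ d) {p : unitInterval}
    (hp : (p : ℝ) < criticalProb (zdGraph d) (0 : Site d)) (S : Finset (Site d)) (n : ℕ) :
    ∑ y ∈ S, euclidNorm y ^ 2 *
        (bondPercolation (zdGraph d) p).real (openConnGe n (0 : Site d) y □ openConn y 0) ≤
      (2 * d * (p : ℝ)) ^ n * nobleH d 1 n p 0 :=
  sum_sq_weighted_repBubbleTail_le_nobleH p S n (summable_sq_mul_tau_mul_srwConv hd p hp n)

/-- **The tail lands on `f₃`, all pivots (`ℝ≥0∞`), `p < p_c` (`d ≥ 2`)**: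
`Σ_y ‖y‖₂² P_p({0 ←n→ y} ∘ {y ↔ 0}) ≤ (2dp)^n ℋ^{1,n}_p(0)`.
[cite: FitznerVanDerHofstad2016NoBLE, §5.3.3 last paragraph (PTRF 169 (2017) p. 1099)]
[cite: FitznerVanDerHofstad2017, §4.2 (4.3), (4.12); §2.2 (2.21)–(2.23)] -/
theorem tsum_sq_weighted_repBubbleTail_le_nobleH_of_subcritical (hd : 2 ≤ d) {p : unitInterval}
    (hp : (p : ℝ) < criticalProb (zdGraph d) (0 : Site d)) (n : ℕ) :
    ∑' y, ENNReal.ofReal (euclidNorm y ^ 2) *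
        bondPercolation (zdGraph d) p (openConnGe n (0 : Site d) y □ openConn y 0) ≤
      ENNReal.ofReal ((2 * d * (p : ℝ)) ^ n * nobleH d 1 n p 0) :=
  tsum_sq_weighted_repBubbleTail_le_nobleH p n (summable_sq_mul_tau_mul_srwConv hd p hp n)

/-- **The general-cut skeleton of the weighted repulsive bubble, `p < p_c` (`d ≥ 2`), no side condition**:
`Σ_y ‖y‖₂² P_p({0 ←m→ y} ∘ {y ↔ 0}) ≤ Σ_{i ∈ [m,M]} p^i Σ_{u ∈ SAW_i} ‖u(i)‖₂² P^{bonds(u)}_p(u(i) ↔ 0)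
  + (2dp)^{M+1} ℋ^{1,M+1}_p(0)`.
[cite: FitznerVanDerHofstad2016NoBLE, §5.3.1 (5.38) and §5.3.3 (PTRF 169 (2017) pp. 1097, 1099)]
[cite: FitznerVanDerHofstad2017, §4.2 (4.3), (4.12); §2.2 (2.21)] -/
theorem tsum_sq_weighted_repBubble_le_skeleton_of_subcritical (hd : 2 ≤ d) {p : unitInterval}
    (hp : (p : ℝ) < criticalProb (zdGraph d) (0 : Site d)) (m M : ℕ) :
    ∑' y : Site d, ENNReal.ofReal (euclidNorm y ^ 2) *
        bondPercolation (zdGraph d) p (openConnGe m (0 : Site d) y □ openConn y 0) ≤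
      (∑ i ∈ Finset.Icc m M, ENNReal.ofReal ((p : ℝ) ^ i) *
          ∑ u ∈ sawWords d i, ENNReal.ofReal (euclidNorm (wordPos u i) ^ 2) *
            probOff d p ↑(wordEdges u) (openConn (wordPos u i) 0)) +
        ENNReal.ofReal ((2 * d * (p : ℝ)) ^ (M + 1) * nobleH d 1 (M + 1) p 0) :=
  tsum_sq_weighted_repBubble_le_skeleton p m M (summable_sq_mul_tau_mul_srwConv hd p hp (M + 1))

/-- **The skeleton with the repulsion of the explicit pieces dropped, `p < p_c` (`d ≥ 2`), no side condition**:
`Σ_y ‖y‖₂² P_p({0 ←m→ y} ∘ {y ↔ 0}) ≤ Σ_{i ∈ [m,M]} p^i Σ_{u ∈ SAW_i} ‖u(i)‖₂² τ_p(u(i)) + (2dp)^{M+1} ℋ^{1,M+1}_p(0)`.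
[cite: FitznerVanDerHofstad2016NoBLE, §5.3.1 (5.38) and §5.3.3 (PTRF 169 (2017) pp. 1097, 1099)]
[cite: FitznerVanDerHofstad2017, §4.2 (4.3), (4.12); §2.2 (2.21)] -/
theorem tsum_sq_weighted_repBubble_le_skeleton_tau_of_subcritical (hd : 2 ≤ d) {p : unitInterval}
    (hp : (p : ℝ) < criticalProb (zdGraph d) (0 : Site d)) (m M : ℕ) :
    ∑' y : Site d, ENNReal.ofReal (euclidNorm y ^ 2) *
        bondPercolation (zdGraph d) p (openConnGe m (0 : Site d) y □ openConn y 0) ≤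
      (∑ i ∈ Finset.Icc m M, ENNReal.ofReal ((p : ℝ) ^ i) *
          ∑ u ∈ sawWords d i, ENNReal.ofReal (euclidNorm (wordPos u i) ^ 2) *
            ENNReal.ofReal (tau d p 0 (wordPos u i))) +
        ENNReal.ofReal ((2 * d * (p : ℝ)) ^ (M + 1) * nobleH d 1 (M + 1) p 0) :=
  tsum_sq_weighted_repBubble_le_skeleton_tau p m M (summable_sq_mul_tau_mul_srwConv hd p hp (M + 1))

end Literature.Probability.FitznerVanDerHofstad2017

end
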